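import Literature.Topology.PlanarFoliations.WalkPlaneBand
import Literature.Topology.PlanarFoliations.WalkNullTransport
import Literature.Topology.PlanarFoliations.LeafLoopWinding
import Literature.Topology.PlaneTopology.TraceCrossing
import HarnessLib

/-!
# No open leaf spirals onto a null closed walk of the separatrix graph

Topic: Topology / PlanarFoliations, sequel to `WalkPlaneBand.lean` (the plane band `Ψ̂` of the
walk fence: jointly continuous up to the base level, `ι ∘ Ψ` on the side levels, the planar trace
`ω̂` of the walk at the base level), `WalkNullTransport.lean` (null base loop ⇒ the tracked leaves
return: `χ = χ₀` near the base level), `LeafLoopWinding.lean`, `PlaneTopology/TraceCrossing.lean`.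

**Theorem** (`StarData.walk_no_spiral`). Let a closed walk of the separatrix graph of star data,
obeying the turn rule on the side `s`, have **null base loop** (its `g`-image is null-homotopic
in its leaf of `T`) and a **chart-straight piece** in its planar trace (an edge piece read as a
horizontal chart segment, the rest of the trace off the chart box — "the edge is passed once").
Then **no open leaf meets the start transversal of the walk at side-`s` levels accumulating to
the base level**: an open leaf `L` through such a level `τ` would carry the tracked loop
`Ψ(·, τ)` (closed, as the levels return), null-homotopic in the line `L`
(`wind_eq_zero_of_loop_in_open_leaf`: winding number `0` about the two test points
`p± = ι e⁻¹(c, h₀ ± ρ)` off `L`, `ρ` generic by `exists_heights_not_mem_leafHeights`); the plane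
band deforms `ι ∘ Ψ(·, τ)` through closed loops missing `p±` to the trace `ω̂`
(`wind_walkPlaneBand_eq`, uniform convergence `eventually_forall_dist_lt`), whose winding
numbers about `p₋`, `p₊` differ by `±1` (`StraightPiece.wind_sub_wind`) — contradiction. This
is the "no leaf spirals onto a hugged polygon" step (T-a) of the graph case of Novikov's
vanishing-cycle theorem for planar foliations with prong singularities.

## References

* C. Camacho, A. Lins Neto, *Geometric Theory of Foliations*, Birkhäuser (1985), Ch. VII §2
  [CamachoLinsNeto1985].
-/

noncomputable section

open Set Filter Function Metric unitInterval
open _root_.Topology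
open Literature.Topology.FourManifolds Literature.Topology.FourManifolds.Foliation Literature.Topology.PlaneTopology

namespace Literature.Topology.PlanarFoliations

variable {X : Type*} [TopologicalSpace X] [Nonempty X] {F : Foliation ℝ X} {ι : X → ℂ}
variable {B : Type*} [NormedAddCommGroup B] [NormedSpace ℝ B] {M : Type*} [TopologicalSpace M]
  {T : Foliation B M} {g : ℂ → M}

namespace StarData

variable {D : StarData F ι T g} {hι : IsOpenEmbedding ι}
variable (ho : F.IsTransverselyOriented) {J : ℕ → D.WalkJunction hι}
  {ℓ : ∀ k, Path (J k).Kout.base (J (k + 1)).Kin.base} (hℓ : ∀ k, Continuous (toLeafSpace ∘ ℓ k : I → F.LeafSpace))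
  {s : ℝ} (hs : s = 1 ∨ s = -1) (hturn : ∀ k, (J k).jout = (J k).turn s)

/-! ## The planar trace of a closed walk as a periodic loop -/

omit [NormedSpace ℝ B] in
/-- The trace starts at the first prong point. [folklore] -/
theorem walkPlaneBase_apply_zero (n : ℕ) : walkPlaneBase J ℓ n 0 = (D.star (J 0).v (J 0).hv).pt (J 0).jin ((J 0).β, 0) := by
  induction n with
  | zero => rfl
  | succ n ih => show transFun (transFun (walkPlaneBase J ℓ n) _) _ 0 = _; rw [transFun_zero, transFun_zero, ih]

omit [NormedSpace ℝ B] in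
/-- The trace of a nonempty walk ends at the last prong point. [folklore] -/
theorem walkPlaneBase_apply_one (n : ℕ) :
    walkPlaneBase J ℓ (n + 1) 1 = (D.star (J (n + 1)).v (J (n + 1)).hv).pt (J (n + 1)).jin ((J (n + 1)).β, 0) := by
  show transFun (transFun (walkPlaneBase J ℓ n) _) (fun θ ↦ ι (transFun (transFun (fun _ ↦ (J n).Kout.base) (ℓ n))
    (fun _ ↦ (J (n + 1)).Kin.base) θ)) 1 = _
  rw [transFun_one, transFun_one, (J (n + 1)).Kin.ι_base]

omit [NormedSpace ℝ B] in
/-- **The trace of a closed walk is a closed curve.** [folklore] -/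
theorem walkPlaneBase_zero_eq_one {m : ℕ} (hper : J m = J 0) : walkPlaneBase J ℓ m 0 = walkPlaneBase J ℓ m 1 := by
  cases m with
  | zero => rfl
  | succ m => rw [walkPlaneBase_apply_zero, walkPlaneBase_apply_one, hper]

/-- **The planar trace of the walk read as a `1`-periodic loop.** [folklore] -/
def traceLoop (J : ℕ → D.WalkJunction hι) (ℓ : ∀ k, Path (J k).Kout.base (J (k + 1)).Kin.base) (m : ℕ) : ℝ → ℂ :=
  (fun t ↦ walkPlaneBase J ℓ m (projIcc 0 1 zero_le_one t)) ∘ Int.fract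

omit [NormedSpace ℝ B] in
/-- The trace loop is `1`-periodic. [folklore] -/
theorem periodic_traceLoop (m : ℕ) : Periodic (traceLoop J ℓ m) 1 := periodic_comp_fract

omit [NormedSpace ℝ B] in
/-- On `[0, 1]` the trace loop is the trace. [folklore] -/
theorem traceLoop_apply_of_mem {m : ℕ} (hper : J m = J 0) {t : ℝ} (ht : t ∈ Icc (0 : ℝ) 1) :
    traceLoop J ℓ m t = walkPlaneBase J ℓ m (projIcc 0 1 zero_le_one t) := by
  refine comp_fract_apply_of_mem_Icc (f := fun t ↦ walkPlaneBase J ℓ m (projIcc 0 1 zero_le_one t)) ?_ ht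
  show walkPlaneBase J ℓ m (projIcc 0 1 zero_le_one 0) = walkPlaneBase J ℓ m (projIcc 0 1 zero_le_one 1)
  rw [projIcc_left, projIcc_right]
  exact walkPlaneBase_zero_eq_one hper

omit [NormedSpace ℝ B] in
/-- The trace at `θ ∈ I` is the trace loop at `θ`. [folklore] -/
theorem traceLoop_coe {m : ℕ} (hper : J m = J 0) (θ : I) : traceLoop J ℓ m θ = walkPlaneBase J ℓ m θ := by
  rw [traceLoop_apply_of_mem hper θ.2, projIcc_val]

/-! ## The trace is continuous; the band converges uniformly to it -/

include ho hℓ hs hturn in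
/-- **The planar trace is continuous** (the base slice of the jointly continuous plane band).
[folklore] -/
theorem continuous_walkPlaneBase (n : ℕ) : Continuous (walkPlaneBase J ℓ n) := by
  set W := D.walkFence ho hℓ hs hturn n with hW
  have hτ₀S : (J 0).τ₀ ∈ sideLevels (J 0).τ₀ s W.ε := ⟨⟨by linarith [W.ε_pos], by linarith [W.ε_pos]⟩, by simp⟩
  have hc : ContinuousOn (fun θ : I ↦ walkPlaneBand ho hℓ hs hturn n θ (J 0).τ₀) univ :=
    (continuousOn_walkPlaneBand ho hℓ hs hturn n).comp (continuous_id.prodMk continuous_const).continuousOn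
      fun θ _ ↦ ⟨mem_univ _, hτ₀S⟩
  have heq : (fun θ : I ↦ walkPlaneBand ho hℓ hs hturn n θ (J 0).τ₀) = walkPlaneBase J ℓ n :=
    funext fun θ ↦ walkPlaneBand_base ho hℓ hs hturn n θ
  rw [← heq]
  exact continuousOn_univ.1 hc

include ho hℓ hs hturn in
/-- The trace loop of a closed walk is continuous. [folklore] -/
theorem continuous_traceLoop {m : ℕ} (hper : J m = J 0) : Continuous (traceLoop J ℓ m) := by
  refine ContinuousOn.comp_fract'' ((continuous_walkPlaneBase ho hℓ hs hturn m).comp continuous_projIcc).continuousOn ?_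
  show walkPlaneBase J ℓ m (projIcc 0 1 zero_le_one 0) = walkPlaneBase J ℓ m (projIcc 0 1 zero_le_one 1)
  rw [projIcc_left, projIcc_right]
  exact walkPlaneBase_zero_eq_one hper

/-- **The plane band converges uniformly to the trace** as the level tends to the base level
within the side levels. [folklore] -/
theorem eventually_forall_dist_lt (n : ℕ) {d : ℝ} (hd : 0 < d) :
    ∀ᶠ lv in 𝓝 (J 0).τ₀, lv ∈ sideLevels (J 0).τ₀ s (D.walkFence ho hℓ hs hturn n).ε →
      ∀ θ : I, dist (walkPlaneBand ho hℓ hs hturn n θ lv) (walkPlaneBase J ℓ n θ) < d := by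
  set W := D.walkFence ho hℓ hs hturn n with hW
  set S := sideLevels (J 0).τ₀ s W.ε with hS
  set Ψ := walkPlaneBand ho hℓ hs hturn n with hΨ
  have hcont : ContinuousOn (uncurry Ψ) (univ ×ˢ S) := continuousOn_walkPlaneBand ho hℓ hs hturn n
  have hτ₀S : (J 0).τ₀ ∈ S := ⟨⟨by linarith [W.ε_pos], by linarith [W.ε_pos]⟩, by simp⟩
  have hbase : ∀ θ, Ψ θ (J 0).τ₀ = walkPlaneBase J ℓ n θ := walkPlaneBand_base ho hℓ hs hturn n
  have hP : ∀ θ ∈ (univ : Set I), ∀ᶠ z : ℝ × I in 𝓝 ((J 0).τ₀, θ), z.1 ∈ S → dist (Ψ z.2 z.1) (walkPlaneBase J ℓ n z.2) < d := by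
    intro θ _
    have h1 : ContinuousWithinAt (uncurry Ψ) (univ ×ˢ S) (θ, (J 0).τ₀) := hcont (θ, (J 0).τ₀) ⟨mem_univ _, hτ₀S⟩
    have h2 : ∀ᶠ z in 𝓝[univ ×ˢ S] (θ, (J 0).τ₀), dist (uncurry Ψ z) (uncurry Ψ (θ, (J 0).τ₀)) < d / 2 :=
      Metric.tendsto_nhds.1 h1 _ (by positivity)
    rw [eventually_nhdsWithin_iff] at h2
    have h3 : ∀ᶠ z : ℝ × I in 𝓝 ((J 0).τ₀, θ), (z.2, z.1) ∈ univ ×ˢ S → dist (Ψ z.2 z.1) (Ψ θ (J 0).τ₀) < d / 2 :=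
      (continuous_swap.tendsto ((J 0).τ₀, θ)).eventually h2
    have h4 : ∀ᶠ z : ℝ × I in 𝓝 ((J 0).τ₀, θ), dist (walkPlaneBase J ℓ n z.2) (walkPlaneBase J ℓ n θ) < d / 2 := by
      have h5 : ∀ᶠ θ' in 𝓝 θ, dist (walkPlaneBase J ℓ n θ') (walkPlaneBase J ℓ n θ) < d / 2 :=
        Metric.tendsto_nhds.1 ((continuous_walkPlaneBase ho hℓ hs hturn n).tendsto θ) _ (by positivity)
      exact (continuous_snd.tendsto ((J 0).τ₀, θ)).eventually h5
    filter_upwards [h3, h4] with z hz hz' hzS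
    calc dist (Ψ z.2 z.1) (walkPlaneBase J ℓ n z.2)
        ≤ dist (Ψ z.2 z.1) (Ψ θ (J 0).τ₀) + dist (Ψ θ (J 0).τ₀) (walkPlaneBase J ℓ n z.2) := dist_triangle _ _ _
      _ < d / 2 + d / 2 := by
          refine add_lt_add (hz ⟨mem_univ _, hzS⟩) ?_
          rw [hbase θ, dist_comm]; exact hz'
      _ = d := by ring
  have key := IsCompact.eventually_forall_of_forall_eventually
    (P := fun lv θ ↦ lv ∈ S → dist (Ψ θ lv) (walkPlaneBase J ℓ n θ) < d) (isCompact_univ : IsCompact (univ : Set I)) hP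
  filter_upwards [key] with lv hlv hlvS θ
  exact hlv θ (mem_univ _) hlvS

/-! ## The winding number of the band loops -/

omit [Nonempty X] [NormedSpace ℝ B] in
/-- Levels between `τ₀` and a side level are side levels. [folklore] -/
theorem mem_sideLevels_of_between {τ₀ ε τ : ℝ} (hτ : τ ∈ sideLevels τ₀ s ε) {u : ℝ} (hu : u ∈ Icc (0 : ℝ) 1) :
    τ₀ + u * (τ - τ₀) ∈ sideLevels τ₀ s ε := by
  obtain ⟨⟨h1, h2⟩, h3⟩ := hτ
  refine ⟨⟨?_, ?_⟩, ?_⟩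
  · nlinarith [hu.1, hu.2]
  · nlinarith [hu.1, hu.2]
  · have : s * (τ₀ + u * (τ - τ₀) - τ₀) = u * (s * (τ - τ₀)) := by ring
    rw [this]; exact mul_nonneg hu.1 h3

/-- **Along closed side levels missing `p`, the winding number of the band loop about `p` is that
of the trace.** [folklore] -/
theorem wind_walkPlaneBand_eq (n : ℕ) {τ : ℝ} (hτ : τ ∈ sideLevels (J 0).τ₀ s (D.walkFence ho hℓ hs hturn n).ε)
    (hclosed : ∀ u ∈ Icc (0 : ℝ) 1, walkPlaneBand ho hℓ hs hturn n 0 ((J 0).τ₀ + u * (τ - (J 0).τ₀)) =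
      walkPlaneBand ho hℓ hs hturn n 1 ((J 0).τ₀ + u * (τ - (J 0).τ₀)))
    {p : ℂ} (havoid : ∀ u ∈ Icc (0 : ℝ) 1, ∀ θ, walkPlaneBand ho hℓ hs hturn n θ ((J 0).τ₀ + u * (τ - (J 0).τ₀)) ≠ p) :
    wind (fun t ↦ walkPlaneBand ho hℓ hs hturn n (projIcc 0 1 zero_le_one t) τ - p) =
      wind (fun t ↦ walkPlaneBase J ℓ n (projIcc 0 1 zero_le_one t) - p) := by
  set Ψ := walkPlaneBand ho hℓ hs hturn n with hΨ
  set H : ℝ → ℝ → ℂ := fun u t ↦ Ψ (projIcc 0 1 zero_le_one t) ((J 0).τ₀ + u * (τ - (J 0).τ₀)) - p with hH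
  have key := wind_eq_of_homotopy (H := H) ?_ ?_ ?_
  · have h0 : H 0 = fun t ↦ walkPlaneBase J ℓ n (projIcc 0 1 zero_le_one t) - p := by
      funext t
      show Ψ (projIcc 0 1 zero_le_one t) ((J 0).τ₀ + 0 * (τ - (J 0).τ₀)) - p = _
      rw [zero_mul, add_zero, hΨ, walkPlaneBand_base]
    have h1 : H 1 = fun t ↦ Ψ (projIcc 0 1 zero_le_one t) τ - p := by
      funext t
      show Ψ (projIcc 0 1 zero_le_one t) ((J 0).τ₀ + 1 * (τ - (J 0).τ₀)) - p = _
      rw [one_mul, add_sub_cancel]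
    rw [h0, h1] at key
    exact key.symm
  · -- continuity on the square
    have hc : Continuous fun q : ℝ × ℝ ↦ ((projIcc 0 1 zero_le_one q.2, (J 0).τ₀ + q.1 * (τ - (J 0).τ₀)) : I × ℝ) :=
      (continuous_projIcc.comp continuous_snd).prodMk (continuous_const.add (continuous_fst.mul continuous_const))
    have hmaps : MapsTo (fun q : ℝ × ℝ ↦ ((projIcc 0 1 zero_le_one q.2, (J 0).τ₀ + q.1 * (τ - (J 0).τ₀)) : I × ℝ))
        (Icc 0 1 ×ˢ Icc 0 1) (univ ×ˢ sideLevels (J 0).τ₀ s (D.walkFence ho hℓ hs hturn n).ε) :=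
      fun q hq ↦ ⟨mem_univ _, mem_sideLevels_of_between hτ hq.1⟩
    exact ((continuousOn_walkPlaneBand ho hℓ hs hturn n).comp hc.continuousOn hmaps).sub continuousOn_const
  · intro u hu
    show Ψ (projIcc 0 1 zero_le_one 0) _ - p = Ψ (projIcc 0 1 zero_le_one 1) _ - p
    rw [projIcc_left, projIcc_right]
    show Ψ 0 ((J 0).τ₀ + u * (τ - (J 0).τ₀)) - p = Ψ 1 ((J 0).τ₀ + u * (τ - (J 0).τ₀)) - p
    rw [hclosed u hu]
  · exact fun u hu t _ ↦ sub_ne_zero.2 (havoid u hu _)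

/-! ## No open leaf spirals onto a null closed walk -/

variable [T2Space X] [SecondCountableTopology X] [LocallyConnectedSpace B] [Nonempty B]

include ho hℓ hs hturn in
/-- **No open leaf meets the start transversal of a null closed walk with a chart-straight piece
at side levels accumulating to the base level.** [cite: CamachoLinsNeto1985, Ch. VII §2] -/
theorem walk_no_spiral (hbi : IsBiOriented F) {m : ℕ} (hper : J m = J 0) {e : OpenPartialHomeomorph X (ℝ × ℝ)}
    (he : e ∈ F.atlas) (heu : e.target = univ) (P : StraightPiece ι e (traceLoop J ℓ m))
    (hnull : ∃ (p : T.LeafSpace) (L : Path p p), (∀ θ, L θ = toLeafSpace (D.walkBase J ℓ m θ)) ∧ L.Homotopic (Path.refl p))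
    {y₀ : X} (hL : ¬ IsCompact (F.leaf y₀)) :
    ∃ η > (0 : ℝ), ∀ τ ∈ Ioo ((J 0).τ₀ - η) ((J 0).τ₀ + η), 0 < s * (τ - (J 0).τ₀) →
      (J 0).Kin.T₁ (J 0).χ₀ τ ∉ F.leaf y₀ := by
  set W := D.walkFence ho hℓ hs hturn m with hW
  set Ψ := walkPlaneBand ho hℓ hs hturn m with hΨ
  set ω := walkPlaneBase J ℓ m with hω
  -- generic test heights off the leaf `L`
  obtain ⟨ρ, hρ, hρp, hρm⟩ := exists_heights_not_mem_leafHeights (F := F) he y₀ P.h₀ P.hr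
  have hp : ∀ lv : ℝ, lv = ρ ∨ lv = -ρ → ∀ z ∈ F.leaf y₀, ι z ≠ P.pt lv := by
    rintro lv (rfl | rfl)
    · exact image_ne_of_not_mem_leafHeights he hρp hι.injective
    · have h : P.h₀ + -ρ ∉ F.leafHeights e y₀ := by rw [← sub_eq_add_neg]; exact hρm
      exact image_ne_of_not_mem_leafHeights he h hι.injective
  -- the test points are off the trace, with a margin
  have hωc : Continuous ω := continuous_walkPlaneBase ho hℓ hs hturn m
  have hne : ∀ lv : ℝ, lv = ρ ∨ lv = -ρ → ∀ θ : I, ω θ ≠ P.pt lv := fun lv hlv θ ↦ by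
    rw [hω, ← traceLoop_coe hper θ]
    refine P.ne_pt hι.injective heu (periodic_traceLoop m) ?_ ?_ θ
    · rcases hlv with rfl | rfl <;> [exact hρ.1.ne'; exact neg_ne_zero.2 hρ.1.ne']
    · rcases hlv with rfl | rfl <;> simp [abs_of_pos hρ.1, hρ.2]
  have hKc : IsCompact (range ω) := isCompact_range hωc
  have hdpos : ∀ lv : ℝ, lv = ρ ∨ lv = -ρ → 0 < infDist (P.pt lv) (range ω) := fun lv hlv ↦
    (hKc.isClosed.notMem_iff_infDist_pos (range_nonempty ω)).1 (by rintro ⟨θ, hθ⟩; exact hne lv hlv θ hθ)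
  set d := min (infDist (P.pt ρ) (range ω)) (infDist (P.pt (-ρ)) (range ω)) with hd
  have hd0 : 0 < d := lt_min (hdpos ρ (Or.inl rfl)) (hdpos (-ρ) (Or.inr rfl))
  have hfar : ∀ lv : ℝ, lv = ρ ∨ lv = -ρ → ∀ {z : ℂ} {θ : I}, dist z (ω θ) < d → z ≠ P.pt lv := by
    intro lv hlv z θ hz heq
    rw [heq] at hz
    have h1 : d ≤ infDist (P.pt lv) (range ω) := by
      rcases hlv with rfl | rfl <;> [exact min_le_left _ _; exact min_le_right _ _]
    have h2 : infDist (P.pt lv) (range ω) ≤ dist (P.pt lv) (ω θ) := infDist_le_dist_of_mem ⟨θ, rfl⟩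
    linarith
  -- uniform convergence of the band, and the return of the levels
  obtain ⟨η₁, hη₁, hη₁ε, hχ⟩ := walkFence_χ_eq_χ₀_of_null ho J ℓ hℓ hs hturn hper hnull
  obtain ⟨η₂, hη₂, hη₂sub⟩ := Metric.eventually_nhds_iff.1 (eventually_forall_dist_lt ho hℓ hs hturn m hd0)
  refine ⟨min η₁ η₂, lt_min hη₁ hη₂, fun τ hτ hsτ hyτ ↦ ?_⟩
  have hτ₁ : τ ∈ Ioo ((J 0).τ₀ - η₁) ((J 0).τ₀ + η₁) :=
    ⟨by linarith [hτ.1, min_le_left η₁ η₂], by linarith [hτ.2, min_le_left η₁ η₂]⟩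
  have hτW : τ ∈ Ioo ((J 0).τ₀ - W.ε) ((J 0).τ₀ + W.ε) := ⟨by linarith [hτ₁.1], by linarith [hτ₁.2]⟩
  have hτS : τ ∈ sideLevels (J 0).τ₀ s W.ε := ⟨hτW, hsτ.le⟩
  -- the levels between `τ₀` and `τ`
  have hbetween : ∀ u ∈ Icc (0 : ℝ) 1, (J 0).τ₀ + u * (τ - (J 0).τ₀) ∈ Ioo ((J 0).τ₀ - min η₁ η₂) ((J 0).τ₀ + min η₁ η₂) := by
    intro u hu
    have h1 : |u * (τ - (J 0).τ₀)| ≤ |τ - (J 0).τ₀| := by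
      rw [abs_mul, abs_of_nonneg hu.1]; exact mul_le_of_le_one_left (abs_nonneg _) hu.2
    have h2 : |τ - (J 0).τ₀| < min η₁ η₂ := abs_sub_lt_iff.2 ⟨by linarith [hτ.2], by linarith [hτ.1]⟩
    constructor <;> [linarith [neg_abs_le (u * (τ - (J 0).τ₀))]; linarith [le_abs_self (u * (τ - (J 0).τ₀))]]
  have hclosed : ∀ u ∈ Icc (0 : ℝ) 1, Ψ 0 ((J 0).τ₀ + u * (τ - (J 0).τ₀)) = Ψ 1 ((J 0).τ₀ + u * (τ - (J 0).τ₀)) := by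
    intro u hu
    set lv := (J 0).τ₀ + u * (τ - (J 0).τ₀) with hlv
    have hlv₁ : lv ∈ Ioo ((J 0).τ₀ - η₁) ((J 0).τ₀ + η₁) :=
      ⟨by linarith [(hbetween u hu).1, min_le_left η₁ η₂], by linarith [(hbetween u hu).2, min_le_left η₁ η₂]⟩
    have hlvW : lv ∈ Ioo ((J 0).τ₀ - W.ε) ((J 0).τ₀ + W.ε) := ⟨by linarith [hlv₁.1], by linarith [hlv₁.2]⟩
    obtain ⟨h0, h1⟩ := walkPlaneBand_ends ho hℓ hs hturn m hlvW
    rw [hΨ, h0, h1, hχ lv hlv₁]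
    have : (D.star (J m).v (J m).hv).pt (J m).jin ((J m).β, (J 0).χ₀ lv) = (D.star (J 0).v (J 0).hv).pt (J 0).jin ((J 0).β, (J 0).χ₀ lv) := by
      rw [hper]
    exact this.symm
  have havoid : ∀ sg : ℝ, sg = ρ ∨ sg = -ρ → ∀ u ∈ Icc (0 : ℝ) 1, ∀ θ, Ψ θ ((J 0).τ₀ + u * (τ - (J 0).τ₀)) ≠ P.pt sg := by
    intro sg hsg u hu θ
    have hlvS : (J 0).τ₀ + u * (τ - (J 0).τ₀) ∈ sideLevels (J 0).τ₀ s W.ε := mem_sideLevels_of_between hτS hu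
    have hlv₂ : dist ((J 0).τ₀ + u * (τ - (J 0).τ₀)) (J 0).τ₀ < η₂ := by
      rw [Real.dist_eq]
      have := hbetween u hu
      exact abs_sub_lt_iff.2 ⟨by linarith [this.2, min_le_right η₁ η₂], by linarith [this.1, min_le_right η₁ η₂]⟩
    exact hfar sg hsg (hη₂sub hlv₂ hlvS θ)
  -- the band loop at `τ` winds like the trace about `p±` ...
  have hwindeq : ∀ sg : ℝ, sg = ρ ∨ sg = -ρ →
      wind (fun t ↦ Ψ (projIcc 0 1 zero_le_one t) τ - P.pt sg) = wind (fun t ↦ traceLoop J ℓ m t - P.pt sg) := by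
    intro sg hsg
    rw [hΨ, wind_walkPlaneBand_eq ho hℓ hs hturn m hτS hclosed (havoid sg hsg)]
    exact wind_congr fun t ht ↦ by rw [traceLoop_apply_of_mem hper ht]
  -- ... and winds `0`, being the image of a loop of the open leaf `L`
  obtain ⟨hΦΨ, hΨc, hΨ0, hΨ1, -, -⟩ := W.track τ hτW hsτ
  have hχτ : W.χ τ = (J 0).χ₀ τ := hχ τ hτ₁
  have hc1 : W.Ψ 1 τ = W.Ψ 0 τ := by
    rw [hΨ1, hΨ0]
    have : (J m).Kin.T₁ W.χ τ = (J 0).Kin.T₁ W.χ τ := by rw [hper]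
    rw [this]
    simp only [ProngBox.T₁, hχτ]
  have hc0 : W.Ψ 0 τ ∈ F.leaf y₀ := by rw [hΨ0]; exact hyτ
  have hwind0 : ∀ sg : ℝ, sg = ρ ∨ sg = -ρ → wind (fun t ↦ Ψ (projIcc 0 1 zero_le_one t) τ - P.pt sg) = 0 := by
    intro sg hsg
    have h := wind_eq_zero_of_loop_in_open_leaf hbi hι.continuous hL hΨc hc0 hc1 (hp sg hsg)
    have heq : (fun t ↦ ι (W.Ψ (projIcc 0 1 zero_le_one t) τ) - P.pt sg) = fun t ↦ Ψ (projIcc 0 1 zero_le_one t) τ - P.pt sg := by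
      funext t
      rw [hΨ, walkPlaneBand_eq_ι ho hℓ hs hturn m hτW hsτ]
    rw [heq] at h
    exact h
  -- contradiction with the jump of the winding numbers of the trace across the straight piece
  have hjump := P.wind_sub_wind hι heu (continuous_traceLoop ho hℓ hs hturn hper) (periodic_traceLoop m) hρ
  rw [← hwindeq (-ρ) (Or.inr rfl), ← hwindeq ρ (Or.inl rfl), hwind0 ρ (Or.inl rfl), hwind0 (-ρ) (Or.inr rfl)] at hjump
  norm_num at hjump

end StarData

end Literature.Topology.PlanarFoliations
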